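import Summits.AtomisticToContinuum.HydrodynamicLimit.Theorems.EquilibriumClampedCollisionalWindowLD.Negative.PulseAdjacent

/-!
# Cradle pulse: the window (all pairs, jump times, free flight, which sphere is fast) (helper file of the refutation of `EquilibriumClampedCollisionalWindowLD`, stmt-AtomisticToContinuum-13733; see `Cruxes/EquilibriumClampedCollisionalWindowLD/Disproof.lean` and the evidence WITNESS.md; no Theses declaration is asserted positively; refuter-cdisprove-stmt-AtomisticToContinuum-13733-0)
-/

noncomputable section

open Real
open scoped InnerProductSpace

namespace Summit.AtomisticToContinuum.HydrodynamicLimit.Theorems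

namespace EquilibriumClampedCollisionalWindowLDNegative

section BlockAll

variable {E : Type*} [NormedAddCommGroup E] [InnerProductSpace ℝ E]

section BlockTrajectory

variable {P : Params} {e : E} {D : BlockData E}

/-! ### The window: all pairs, jump times, free flight between jumps, left limits -/

/-- Inside the window (`t < tHit (K-1)`) a sphere that has been hit has an analysable successor. -/
theorem succ_le_of_tHit_le (hP : P.Admissible) (hD : DataOK P e D) {k : ℕ} (hk : k ≤ P.K) {t : ℝ}
    (h : tHit P e D k ≤ t) (hw : t < tHit P e D (P.K - 1)) : k + 2 ≤ P.K := by
  by_contra hlt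
  push Not at hlt
  have hKk : P.K - 1 ≤ k := by omega
  have := tHit_mono hP hD hKk hk
  linarith

/-- **Adjacent spheres are at distance `> ε` at every non-transfer time of the window.** -/
theorem adj_sep (hS : P.SepOK) (hD : DataOK P e D) {k : ℕ} (hk : k + 1 ≤ P.K) {t : ℝ}
    (ht0 : 0 ≤ t) (htT : t ≤ P.Tmax) (hw : t < tHit P e D (P.K - 1))
    (hne : t ≠ tHit P e D (k + 1)) : P.ε < ‖pos P e D (k + 1) t - pos P e D k t‖ := by
  have hP := hS.adm
  by_cases h1 : t < tHit P e D k
  · have hk1 : 1 ≤ k := by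
      rcases Nat.eq_zero_or_pos k with h | h
      · subst h; simp at h1; linarith
      · exact h
    exact adj_uu hP hD hk1 hk ht0 htT h1
  push Not at h1
  by_cases h2 : t < tHit P e D (k + 1)
  · exact adj_cu hP hD hk h1 h2
  push Not at h2
  have h2' : tHit P e D (k + 1) < t := lt_of_le_of_ne h2 (Ne.symm hne)
  have hk2 : k + 1 + 2 ≤ P.K := succ_le_of_tHit_le hP hD hk h2 hw
  have hk2' : k + 2 ≤ P.K := by omega
  by_cases h3 : t < tHit P e D (k + 2)
  · exact adj_sc hP hD hk2' h2' h3
  · push Not at h3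
    exact adj_ss hS hD hk2' h3 htT

/-- **All pairs**: in the window, two spheres of the block are at distance `> ε` unless they are
adjacent and it is their transfer time. -/
theorem pair_sep (hS : P.SepOK) (hD : DataOK P e D) {k l : ℕ} (hkl : k < l) (hl : l ≤ P.K) {t : ℝ}
    (ht0 : 0 ≤ t) (htT : t ≤ P.Tmax) (hw : t < tHit P e D (P.K - 1))
    (hne : l = k + 1 → t ≠ tHit P e D l) : P.ε < ‖pos P e D l t - pos P e D k t‖ := by
  have hP := hS.adm
  have hK1 : 1 ≤ P.K := by omega
  have hphase : ∀ i, i ≤ P.K → t < tHit P e D i ∨ i + 1 ≤ P.K := by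
    intro i hi
    rcases Nat.lt_or_ge i P.K with h | h
    · exact Or.inr h
    · left
      have hiK : i = P.K := le_antisymm hi h
      subst hiK
      have := tHit_lt_succ hP hD (k := P.K - 1) (by omega)
      rw [Nat.sub_add_cancel hK1] at this
      linarith
  rcases Nat.lt_or_ge l (k + 2) with h | h
  · have hlk : l = k + 1 := by omega
    subst hlk
    exact adj_sep hS hD hl ht0 htT hw (hne rfl)
  · exact sep_two_apart hS hD h hl ht0 htT (hphase k (by omega)) (hphase l hl)

/-- At a transfer time of the window, the transferring pair is the ONLY pair in contact. -/
theorem contact_unique (hS : P.SepOK) (hD : DataOK P e D) {j : ℕ} (hj : j + 2 ≤ P.K)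
    (hw : tHit P e D (j + 1) < tHit P e D (P.K - 1)) (hT : tHit P e D (j + 1) ≤ P.Tmax)
    {k l : ℕ} (hkl : k < l) (hl : l ≤ P.K)
    (hc : ‖pos P e D l (tHit P e D (j + 1)) - pos P e D k (tHit P e D (j + 1))‖ = P.ε) :
    k = j ∧ l = j + 1 := by
  have hP := hS.adm
  by_contra hne
  have hne' : l = k + 1 → tHit P e D (j + 1) ≠ tHit P e D l := by
    intro hlk heq
    subst hlk
    have hkj : k ≠ j := fun h => hne ⟨h, by rw [h]⟩
    rcases lt_or_gt_of_ne hkj with h | h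
    · have := tHit_strictMonoOn hP hD (Nat.succ_lt_succ h) (by omega : j + 1 ≤ P.K)
      linarith
    · have := tHit_strictMonoOn hP hD (Nat.succ_lt_succ h) hl
      linarith
  have := pair_sep hS hD hkl hl (tHit_nonneg hP hD (by omega)) hT hw hne'
  linarith

/-- **Free flight between jump times**: if `(s, t]` (inside the window) contains no jump time,
every sphere of the block flies freely from `s` to `t`. -/
theorem freeFlight_between (hP : P.Admissible) (hD : DataOK P e D) {s t : ℝ} (hs0 : 0 ≤ s)
    (hst : s ≤ t) (hw : t < tHit P e D (P.K - 1))
    (hC : ∀ c ∈ jumpTimes P e D, c ∉ Set.Ioc s t) {k : ℕ} (hk : k ≤ P.K) :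
    pos P e D k t = pos P e D k s + (t - s) • vel P e D k s ∧ vel P e D k t = vel P e D k s := by
  by_cases h1 : t < tHit P e D k
  · have h1s : s < tHit P e D k := hst.trans_lt h1
    rw [pos_untouched h1, pos_untouched h1s, vel_untouched h1, vel_untouched h1s]
    exact ⟨by rw [sub_smul]; abel, rfl⟩
  push Not at h1
  have hk2 : k + 2 ≤ P.K := succ_le_of_tHit_le hP hD hk h1 hw
  -- `tHit k ≤ s`
  have h1s : tHit P e D k ≤ s := by
    rcases Nat.eq_zero_or_pos k with h | hkpos
    · subst h; simpa using hs0
    · by_contra hlt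
      push Not at hlt
      exact hC _ (tHit_mem_jumpTimes hkpos (by omega)) ⟨hlt, h1⟩
  by_cases h2 : t < tHit P e D (k + 1)
  · have h2s : s < tHit P e D (k + 1) := hst.trans_lt h2
    rw [pos_carrier h1 h2, pos_carrier h1s h2s, vel_carrier h1 h2, vel_carrier h1s h2s]
    exact ⟨by module, rfl⟩
  push Not at h2
  have h2s : tHit P e D (k + 1) ≤ s := by
    by_contra hlt
    push Not at hlt
    exact hC _ (tHit_mem_jumpTimes (Nat.succ_le_succ (Nat.zero_le _)) (by omega)) ⟨hlt, h2⟩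
  rw [pos_spent h1 h2, pos_spent h1s h2s, vel_spent h1 h2, vel_spent h1s h2s]
  exact ⟨by module, rfl⟩

/-- The left-limit velocity of sphere `k` at the transfer time `tHit (j+1)`. -/
def velL (P : Params) (e : E) (D : BlockData E) (j k : ℕ) : E :=
  if k = j then (carrier P e D j).W else if k = j + 1 then D.η (j + 1)
  else vel P e D k (tHit P e D (j + 1))

/-- **Just before a transfer**: on `(tHit j, tHit (j+1))` every sphere flies with the constant
velocity `velL j k` into its position at `tHit (j+1)`. -/
theorem before_transfer (hP : P.Admissible) (hD : DataOK P e D) {j : ℕ} (hj : j + 2 ≤ P.K) {k : ℕ}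
    (hk : k ≤ P.K) {t : ℝ} (ht1 : tHit P e D j < t) (ht2 : t < tHit P e D (j + 1)) :
    vel P e D k t = velL P e D j k ∧
      pos P e D k t = pos P e D k (tHit P e D (j + 1)) - (tHit P e D (j + 1) - t) • velL P e D j k := by
  have hj1 : j + 1 ≤ P.K := (Nat.le_succ _).trans hj
  have hjK : j ≤ P.K := (Nat.le_succ _).trans hj1
  set c := tHit P e D (j + 1) with hcdef
  rcases Nat.lt_trichotomy k j with hlt | heq | hgt
  · -- spent throughout
    have hk1 : k + 1 ≤ j := hlt
    have hsp : tHit P e D (k + 1) ≤ tHit P e D j := tHit_mono hP hD hk1 hjK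
    have h0 : tHit P e D k ≤ tHit P e D j := (tHit_lt_succ hP hD (by omega)).le.trans hsp
    have hcj : tHit P e D j < c := tHit_lt_succ hP hD hj1
    have hvL : velL P e D j k = ρk P e D k := by
      rw [velL, if_neg hlt.ne, if_neg (by omega), vel_spent (h0.trans hcj.le) (hsp.trans hcj.le)]
    rw [hvL, vel_spent (h0.trans ht1.le) (hsp.trans ht1.le), pos_spent (h0.trans ht1.le) (hsp.trans ht1.le),
      pos_spent (h0.trans hcj.le) (hsp.trans hcj.le)]
    exact ⟨rfl, by module⟩
  · -- the carrier
    subst heq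
    have hvL : velL P e D k k = (carrier P e D k).W := by rw [velL, if_pos rfl]
    rw [hvL, vel_carrier ht1.le ht2, pos_carrier ht1.le ht2,
      pos_spent (tHit_lt_succ hP hD hj1).le le_rfl, qk_eq]
    refine ⟨rfl, ?_⟩
    rw [hcdef, sub_self, zero_smul, add_zero]
    module
  · rcases Nat.lt_or_ge (j + 1) k with hgt' | hle
    · -- untouched, far ahead
      have hkc : c < tHit P e D k := by
        have := tHit_strictMonoOn hP hD hgt' hk; exact this
      have hvL : velL P e D j k = D.η k := by
        rw [velL, if_neg (by omega), if_neg (by omega), vel_untouched hkc]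
      rw [hvL, vel_untouched (ht2.trans hkc), pos_untouched (ht2.trans hkc), pos_untouched hkc]
      exact ⟨rfl, by rw [sub_smul]; abel⟩
    · -- the target
      have hkj : k = j + 1 := by omega
      subst hkj
      have hvL : velL P e D j (j + 1) = D.η (j + 1) := by
        rw [velL, if_neg (by omega), if_pos rfl]
      rw [hvL, vel_untouched ht2, pos_untouched ht2,
        pos_carrier le_rfl (tHit_lt_succ hP hD hj), sub_self, zero_smul, add_zero,
        carrier_p_eq hP hD hj1]
      exact ⟨rfl, by rw [sub_smul]; abel⟩

/-- The jump at a transfer: the two new velocities. -/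
theorem vel_at_transfer (hP : P.Admissible) (hD : DataOK P e D) {j : ℕ} (hj : j + 2 ≤ P.K) :
    vel P e D j (tHit P e D (j + 1)) = (carrier P e D j).W - ck P e D j • nk P e D j ∧
      vel P e D (j + 1) (tHit P e D (j + 1)) = D.η (j + 1) + ck P e D j • nk P e D j := by
  have hj1 : j + 1 ≤ P.K := (Nat.le_succ _).trans hj
  rw [vel_spent (tHit_lt_succ hP hD hj1).le le_rfl, vel_carrier le_rfl (tHit_lt_succ hP hD hj)]
  exact ⟨rfl, rfl⟩

/-- Away from the transferring pair nothing jumps. -/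
theorem velL_of_ne {j k : ℕ} (h1 : k ≠ j) (h2 : k ≠ j + 1) :
    velL P e D j k = vel P e D k (tHit P e D (j + 1)) := by
  rw [velL, if_neg h1, if_neg h2]

/-- The carrier's left-limit velocity is its flight velocity. [folklore] -/
@[simp] theorem velL_self (j : ℕ) : velL P e D j j = (carrier P e D j).W := by rw [velL, if_pos rfl]

/-- The target's left-limit velocity is its untouched velocity. [folklore] -/
@[simp] theorem velL_succ (j : ℕ) : velL P e D j (j + 1) = D.η (j + 1) := by
  rw [velL, if_neg (by omega), if_pos rfl]

/-! ### Which sphere is fast -/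

/-- At every time of the window exactly one sphere can be fast: there is `j` with
`‖vel j t‖ ≤ Vhi` and every other sphere has speed `≤ max u ρs`. -/
theorem exists_carrier (hP : P.Admissible) (hD : DataOK P e D) {t : ℝ} (ht0 : 0 ≤ t)
    (hw : t < tHit P e D (P.K - 1)) :
    ∃ j, j ≤ P.K ∧ ‖vel P e D j t‖ ≤ P.Vhi ∧
      ∀ k, k ≤ P.K → k ≠ j → ‖vel P e D k t‖ ≤ max P.u P.ρs := by
  classical
  set j := Nat.findGreatest (fun k => tHit P e D k ≤ t) P.K with hj
  have hj0 : tHit P e D j ≤ t := by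
    have := Nat.findGreatest_spec (P := fun k => tHit P e D k ≤ t) (Nat.zero_le P.K) (by simpa using ht0)
    exact this
  have hjK : j ≤ P.K := Nat.findGreatest_le _
  have hj2 : j + 2 ≤ P.K := succ_le_of_tHit_le hP hD hjK hj0 hw
  have hmax : ∀ k, j < k → k ≤ P.K → t < tHit P e D k := by
    intro k hjk hk
    by_contra hle
    push Not at hle
    exact Nat.findGreatest_is_greatest hjk hk hle
  refine ⟨j, hjK, ?_, fun k hk hkj => ?_⟩
  · rw [vel_carrier hj0 (hmax (j + 1) (Nat.lt_succ_self j) (by omega))]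
    exact (stepFacts hP hD (by omega : j + 1 ≤ P.K)).W_le
  · rcases lt_or_gt_of_ne hkj with hlt | hgt
    · -- spent
      have hsp : tHit P e D (k + 1) ≤ t := (tHit_mono hP hD (Nat.succ_le_of_lt hlt) hjK).trans hj0
      have h0 : tHit P e D k ≤ t := (tHit_lt_succ hP hD (by omega)).le.trans hsp
      rw [vel_spent h0 hsp]
      exact ((stepFacts hP hD (by omega : k + 1 ≤ P.K)).ρ_le).trans (le_max_right _ _)
    · -- untouched (`k ≥ 1`)
      rw [vel_untouched (hmax k hgt hk)]
      exact (hD.η_le k (by omega) hk).trans (le_max_left _ _)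

/-- All speeds in the window are at most `Vhi`. -/
theorem vel_le_Vhi (hP : P.Admissible) (hD : DataOK P e D) (hmax : max P.u P.ρs ≤ P.Vhi) {t : ℝ}
    (ht0 : 0 ≤ t) (hw : t < tHit P e D (P.K - 1)) {k : ℕ} (hk : k ≤ P.K) :
    ‖vel P e D k t‖ ≤ P.Vhi := by
  obtain ⟨j, -, hj, hrest⟩ := exists_carrier hP hD ht0 hw
  by_cases h : k = j
  · subst h; exact hj
  · exact (hrest k hk h).trans hmax

end BlockTrajectory

end BlockAll

end EquilibriumClampedCollisionalWindowLDNegative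

end Summit.AtomisticToContinuum.HydrodynamicLimit.Theorems

end
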